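import Mathlib
import Summits.NavierStokesRegularity.NavierStokesRegularity.Theorems.DssFarFieldSlavingBlowupTypeIDssProfileGaussianGapIdentities
import Literature.Analysis.FluidPDE.WholeSpaceIBPEnstrophy
import HarnessLib

/-!
# Gaussian enstrophy under a small Type-I constant, file 1/4: two more Gaussian identities and a
  weighted Cauchy–Schwarz inequality (pub-ns-dss T38/T31 scope Row 3 = «T31-G»; route `DssFarFieldSlaving`,
  crux `BlowupTypeIDssProfile`, stmt-NavierStokesRegularity-0155 — SUPPORT, label-free; typer g7; lead A215)

HONEST FRAMING. Label-free analysis helper: whole-space identities against the unit-time heat kernel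
`K = heatKernel 1` (`∇K = −½ y K`) for BOUNDED smooth fields on `ℝ³` (a HYPOTHETICAL similarity
vorticity `Ω` and velocity `U`); nothing is derived from Type-I membership here, no census word is
set by this file, nothing numeric; nothing here bears on Navier–Stokes regularity or blow-up.

CONTENTS. `integral_heatKernel_inner_stretching_eq` — the VORTEX-STRETCHING INTEGRATION BY PARTS
with the Gaussian weight: for `div Ω = 0`,
`∫K⟪DU[Ω], Ω⟫ = ½∫K⟪y,Ω⟫⟪U,Ω⟫ − ∫K⟪U, DΩ[Ω]⟫` (the scalar identity `∫θ div Ω + ∫⟪Ω,∇θ⟫ = 0`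
with `θ = K⟪U,Ω⟫`); `integral_heatKernel_norm_sq_mul_norm_sq_eq` — the GAUSSIAN MOMENT IDENTITY
`∫K|y|²|Ω|² = 6∫K|Ω|² + 4∫K⟪DΩ[y], Ω⟫` (the same scalar identity with `θ = K|Ω|²` and the
field `y ↦ y`, `div = 3`; equivalently `|y|²K = 4ΔK + 6K`); `le_sqrt_mul_sqrt_of_forall_le`
(`X ≤ εA + B/(4ε)` for all `ε > 0` ⇒ `X ≤ √A √B`) and the weighted Cauchy–Schwarz inequality
`integral_heatKernel_mul_le_sqrt_mul_sqrt` (`∫K a b ≤ √(∫K a²) √(∫K b²)` for continuous `a, b` of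
polynomial growth). Consumers: files 2–4 of T31-G. [this file; typer T31-G, lead A215]
-/

noncomputable section

set_option linter.dupNamespace false

namespace Summit.NavierStokesRegularity.NavierStokesRegularity.Theorems.GaussianGap

open Set Function Filter MeasureTheory InnerProductSpace Real Metric
open scoped RealInnerProductSpace ContDiff Topology BigOperators
open Literature.Analysis Literature.Analysis.FluidPDE Literature.Analysis.UnboundedOperators
open Summit.NavierStokesRegularity.NavierStokesRegularity.Theorems

/-- `K = heatKernel 1` is `C¹` on `ℝ³`. [folklore] -/
theorem contDiff_one_heatKernel_one : ContDiff ℝ 1 (heatKernel (E := EuclideanSpace ℝ (Fin 3)) 1) := by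
  have e : heatKernel (E := EuclideanSpace ℝ (Fin 3)) 1 = fun x =>
      (4 * π * 1) ^ (-(Module.finrank ℝ (EuclideanSpace ℝ (Fin 3)) : ℝ) / 2) *
        Real.exp (-‖x‖ ^ 2 / (4 * 1)) := rfl
  rw [e]
  exact contDiff_const.mul (Real.contDiff_exp.comp ((contDiff_norm_sq ℝ).neg.div_const _))

/-- `DK(y)[v] = −½ K(y) ⟪y, v⟫` for `K = heatKernel 1`. [folklore] -/
theorem fderiv_heatKernel_one_apply (y v : EuclideanSpace ℝ (Fin 3)) :
    fderiv ℝ (heatKernel (E := EuclideanSpace ℝ (Fin 3)) 1) y v =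
      -(1 / 2 : ℝ) * heatKernel 1 y * ⟪y, v⟫ := by
  rw [← inner_gradient_left, gradient_heatKernel_one, real_inner_smul_left]

/-- **Gaussian stretching identity (whole space).** For `U, Ω ∈ C¹(ℝ³; ℝ³)` bounded with bounded
derivatives and `div Ω = 0`,
`∫ K ⟪DU(y)[Ω(y)], Ω(y)⟫ dy = ½ ∫ K ⟪y, Ω(y)⟫ ⟪U(y), Ω(y)⟫ dy − ∫ K ⟪U(y), DΩ(y)[Ω(y)]⟫ dy`,
`K = heatKernel 1`: the whole-space identity `∫ θ div Ω + ∫ ⟪Ω, ∇θ⟫ = 0` for `θ = K ⟪U, Ω⟫`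
(`∇K = −½ y K`). Moves the derivative off the stretched field `U` onto `Ω`, at the price of one
Gaussian moment. [folklore] -/
theorem integral_heatKernel_inner_stretching_eq {C : ℝ}
    {U Ω : EuclideanSpace ℝ (Fin 3) → EuclideanSpace ℝ (Fin 3)} (hU : ContDiff ℝ 1 U)
    (hΩ : ContDiff ℝ 1 Ω) (hdivΩ : VectorCalculus.IsDivFree Ω) (hUb : ∀ y, ‖U y‖ ≤ C)
    (hΩb : ∀ y, ‖Ω y‖ ≤ C) (hDUb : ∀ y, ‖fderiv ℝ U y‖ ≤ C) (hDΩb : ∀ y, ‖fderiv ℝ Ω y‖ ≤ C) :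
    ∫ y, heatKernel 1 y * ⟪fderiv ℝ U y (Ω y), Ω y⟫ =
      (1 / 2 : ℝ) * (∫ y, heatKernel 1 y * (⟪y, Ω y⟫ * ⟪U y, Ω y⟫)) -
        ∫ y, heatKernel 1 y * ⟪U y, fderiv ℝ Ω y (Ω y)⟫ := by
  have hC : 0 ≤ C := (norm_nonneg _).trans (hUb 0)
  have hK1 := contDiff_one_heatKernel_one
  have hKd : Differentiable ℝ (heatKernel (E := EuclideanSpace ℝ (Fin 3)) 1) :=
    hK1.differentiable one_ne_zero
  have hUd : Differentiable ℝ U := hU.differentiable one_ne_zero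
  have hΩd : Differentiable ℝ Ω := hΩ.differentiable one_ne_zero
  -- `θ = K ⟪U, Ω⟫`
  have hin : ContDiff ℝ 1 fun y => ⟪U y, Ω y⟫ := hU.inner ℝ hΩ
  have hθ : ContDiff ℝ 1 fun y => heatKernel 1 y * ⟪U y, Ω y⟫ := hK1.mul hin
  have hgradθ : ∀ y, ⟪Ω y, gradient (fun y => heatKernel 1 y * ⟪U y, Ω y⟫) y⟫ =
      -(1 / 2 : ℝ) * (heatKernel 1 y * (⟪y, Ω y⟫ * ⟪U y, Ω y⟫)) +
        (heatKernel 1 y * ⟪fderiv ℝ U y (Ω y), Ω y⟫ +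
          heatKernel 1 y * ⟪U y, fderiv ℝ Ω y (Ω y)⟫) := by
    intro y
    have hind : DifferentiableAt ℝ (fun y => ⟪U y, Ω y⟫) y := (hUd y).inner ℝ (hΩd y)
    rw [real_inner_comm, inner_gradient_left, fderiv_fun_mul (hKd y) hind,
      _root_.add_apply, _root_.smul_apply, _root_.smul_apply,
      fderiv_inner_apply ℝ (hUd y) (hΩd y), fderiv_heatKernel_one_apply, smul_eq_mul, smul_eq_mul,
      real_inner_comm (Ω y) (fderiv ℝ U y (Ω y))]
    ring
  -- continuity
  have cK : Continuous (heatKernel (E := EuclideanSpace ℝ (Fin 3)) 1) := continuous_heatKernel 1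
  have cU : Continuous U := hU.continuous
  have cΩ : Continuous Ω := hΩ.continuous
  have cDΩ : Continuous (fderiv ℝ Ω) := hΩ.continuous_fderiv one_ne_zero
  have cDU : Continuous (fderiv ℝ U) := hU.continuous_fderiv one_ne_zero
  have cgθ : Continuous (gradient fun y => heatKernel 1 y * ⟪U y, Ω y⟫) :=
    (PineauVicol2026.contDiff_gradient (n := 0) (by simpa using hθ)).continuous
  -- integrability
  have i0 : Integrable fun y => (heatKernel 1 y * ⟪U y, Ω y⟫) • Ω y := by
    refine integrable_of_le_poly_heatKernel ((cK.mul (cU.inner cΩ)).smul cΩ) (C := C * C * C)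
      (N := 0) fun y => ?_
    rw [norm_smul, norm_mul, Real.norm_eq_abs, Real.norm_eq_abs, abs_of_pos (heatKernel_one_pos y),
      pow_zero, mul_one]
    have h1 : |⟪U y, Ω y⟫| ≤ C * C :=
      (abs_real_inner_le_norm _ _).trans (mul_le_mul (hUb y) (hΩb y) (norm_nonneg _) hC)
    have hK0 := (heatKernel_one_pos y).le
    calc heatKernel 1 y * |⟪U y, Ω y⟫| * ‖Ω y‖ ≤ heatKernel 1 y * (C * C) * C :=
          mul_le_mul (mul_le_mul_of_nonneg_left h1 hK0) (hΩb y) (norm_nonneg _) (by positivity)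
      _ = C * C * C * heatKernel 1 y := by ring
  have i1 : Integrable fun y => (heatKernel 1 y * ⟪U y, Ω y⟫) *
      VectorCalculus.divergence Ω y := by
    have e : (fun y => (heatKernel 1 y * ⟪U y, Ω y⟫) * VectorCalculus.divergence Ω y) =
        fun _ => (0 : ℝ) := by
      funext y; rw [hdivΩ y, mul_zero]
    rw [e]; exact integrable_zero _ _ _
  have iA : Integrable fun y => heatKernel 1 y * (⟪y, Ω y⟫ * ⟪U y, Ω y⟫) := by
    refine integrable_of_le_poly_heatKernel (cK.mul ((continuous_id.inner cΩ).mul (cU.inner cΩ)))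
      (C := C * (C * C)) (N := 1) fun y => ?_
    rw [Real.norm_eq_abs, abs_mul, abs_of_pos (heatKernel_one_pos y), abs_mul]
    have h1 : |⟪y, Ω y⟫| ≤ (1 + ‖y‖) * C := (abs_real_inner_le_norm _ _).trans
      (mul_le_mul (by linarith [norm_nonneg y]) (hΩb y) (norm_nonneg _) (by linarith [norm_nonneg y]))
    have h2 : |⟪U y, Ω y⟫| ≤ C * C :=
      (abs_real_inner_le_norm _ _).trans (mul_le_mul (hUb y) (hΩb y) (norm_nonneg _) hC)
    have hK0 := (heatKernel_one_pos y).le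
    calc heatKernel 1 y * (|⟪y, Ω y⟫| * |⟪U y, Ω y⟫|)
        ≤ heatKernel 1 y * (((1 + ‖y‖) * C) * (C * C)) :=
          mul_le_mul_of_nonneg_left (mul_le_mul h1 h2 (abs_nonneg _) (by positivity)) hK0
      _ = C * (C * C) * (1 + ‖y‖) ^ 1 * heatKernel 1 y := by ring
  have iS : Integrable fun y => heatKernel 1 y * ⟪fderiv ℝ U y (Ω y), Ω y⟫ := by
    refine integrable_of_le_poly_heatKernel (cK.mul ((cDU.clm_apply cΩ).inner cΩ))
      (C := C * C * C) (N := 0) fun y => ?_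
    rw [Real.norm_eq_abs, abs_mul, abs_of_pos (heatKernel_one_pos y), pow_zero, mul_one]
    have h1 : |⟪fderiv ℝ U y (Ω y), Ω y⟫| ≤ C * C * C :=
      (abs_real_inner_le_norm _ _).trans (mul_le_mul ((ContinuousLinearMap.le_opNorm _ _).trans
        (mul_le_mul (hDUb y) (hΩb y) (norm_nonneg _) hC)) (hΩb y) (norm_nonneg _) (by positivity))
    have hK0 := (heatKernel_one_pos y).le
    calc heatKernel 1 y * |⟪fderiv ℝ U y (Ω y), Ω y⟫| ≤ heatKernel 1 y * (C * C * C) :=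
          mul_le_mul_of_nonneg_left h1 hK0
      _ = C * C * C * heatKernel 1 y := by ring
  have iT : Integrable fun y => heatKernel 1 y * ⟪U y, fderiv ℝ Ω y (Ω y)⟫ := by
    refine integrable_of_le_poly_heatKernel (cK.mul (cU.inner (cDΩ.clm_apply cΩ)))
      (C := C * (C * C)) (N := 0) fun y => ?_
    rw [Real.norm_eq_abs, abs_mul, abs_of_pos (heatKernel_one_pos y), pow_zero, mul_one]
    have h1 : |⟪U y, fderiv ℝ Ω y (Ω y)⟫| ≤ C * (C * C) :=
      (abs_real_inner_le_norm _ _).trans (mul_le_mul (hUb y) ((ContinuousLinearMap.le_opNorm _ _).trans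
        (mul_le_mul (hDΩb y) (hΩb y) (norm_nonneg _) hC)) (norm_nonneg _) hC)
    have hK0 := (heatKernel_one_pos y).le
    calc heatKernel 1 y * |⟪U y, fderiv ℝ Ω y (Ω y)⟫| ≤ heatKernel 1 y * (C * (C * C)) :=
          mul_le_mul_of_nonneg_left h1 hK0
      _ = C * (C * C) * heatKernel 1 y := by ring
  have i2 : Integrable fun y => ⟪Ω y, gradient (fun y => heatKernel 1 y * ⟪U y, Ω y⟫) y⟫ := by
    have e : (fun y => ⟪Ω y, gradient (fun y => heatKernel 1 y * ⟪U y, Ω y⟫) y⟫) =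
        fun y => -(1 / 2 : ℝ) * (heatKernel 1 y * (⟪y, Ω y⟫ * ⟪U y, Ω y⟫)) +
          (heatKernel 1 y * ⟪fderiv ℝ U y (Ω y), Ω y⟫ +
            heatKernel 1 y * ⟪U y, fderiv ℝ Ω y (Ω y)⟫) := funext hgradθ
    rw [e]
    have iST : Integrable fun y => heatKernel 1 y * ⟪fderiv ℝ U y (Ω y), Ω y⟫ +
        heatKernel 1 y * ⟪U y, fderiv ℝ Ω y (Ω y)⟫ := iS.add iT
    exact (iA.const_mul _).add iST
  have key := integral_mul_divergence_add_eq_zero_of_integrable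
    (θ := fun y => heatKernel 1 y * ⟪U y, Ω y⟫) (u := Ω) hθ hΩ i0 i1 i2
  have hzero : ∫ y, (heatKernel 1 y * ⟪U y, Ω y⟫) * VectorCalculus.divergence Ω y = 0 := by
    have e : (fun y => (heatKernel 1 y * ⟪U y, Ω y⟫) * VectorCalculus.divergence Ω y) =
        fun _ => (0 : ℝ) := by
      funext y; rw [hdivΩ y, mul_zero]
    rw [e, integral_zero]
  have hsplit : ∫ y, ⟪Ω y, gradient (fun y => heatKernel 1 y * ⟪U y, Ω y⟫) y⟫ =
      -(1 / 2 : ℝ) * (∫ y, heatKernel 1 y * (⟪y, Ω y⟫ * ⟪U y, Ω y⟫)) +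
        ((∫ y, heatKernel 1 y * ⟪fderiv ℝ U y (Ω y), Ω y⟫) +
          ∫ y, heatKernel 1 y * ⟪U y, fderiv ℝ Ω y (Ω y)⟫) := by
    have iST : Integrable fun y => heatKernel 1 y * ⟪fderiv ℝ U y (Ω y), Ω y⟫ +
        heatKernel 1 y * ⟪U y, fderiv ℝ Ω y (Ω y)⟫ := iS.add iT
    rw [integral_congr_ae (Eventually.of_forall hgradθ), integral_add (iA.const_mul _) iST,
      integral_const_mul, integral_add iS iT]
  rw [hzero, hsplit] at key
  linarith

/-- **Gaussian second-moment identity (whole space).** For `Ω ∈ C¹(ℝ³; ℝ³)` bounded with bounded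
derivative, `∫ K |y|² |Ω(y)|² dy = 6 ∫ K |Ω|² + 4 ∫ K ⟪DΩ(y)[y], Ω(y)⟫ dy`, `K = heatKernel 1`:
the whole-space identity `∫ θ div X + ∫ ⟪X, ∇θ⟫ = 0` for `θ = K|Ω|²` and the field `X(y) = y`
(`div X = 3`, `∇K = −½ y K`); equivalently `|y|² K = 4ΔK + 6K`. [folklore] -/
theorem integral_heatKernel_norm_sq_mul_norm_sq_eq {C : ℝ}
    {Ω : EuclideanSpace ℝ (Fin 3) → EuclideanSpace ℝ (Fin 3)} (hΩ : ContDiff ℝ 1 Ω)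
    (hΩb : ∀ y, ‖Ω y‖ ≤ C) (hDΩb : ∀ y, ‖fderiv ℝ Ω y‖ ≤ C) :
    ∫ y, heatKernel 1 y * (‖y‖ ^ 2 * ‖Ω y‖ ^ 2) =
      6 * (∫ y, heatKernel 1 y * ‖Ω y‖ ^ 2) +
        4 * ∫ y, heatKernel 1 y * ⟪fderiv ℝ Ω y y, Ω y⟫ := by
  have hC : 0 ≤ C := (norm_nonneg _).trans (hΩb 0)
  have hK1 := contDiff_one_heatKernel_one
  have hKd : Differentiable ℝ (heatKernel (E := EuclideanSpace ℝ (Fin 3)) 1) :=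
    hK1.differentiable one_ne_zero
  have hΩd : Differentiable ℝ Ω := hΩ.differentiable one_ne_zero
  -- `θ = K |Ω|²`
  have hsq : ContDiff ℝ 1 fun y => ‖Ω y‖ ^ 2 := hΩ.norm_sq ℝ
  have hθ : ContDiff ℝ 1 fun y => heatKernel 1 y * ‖Ω y‖ ^ 2 := hK1.mul hsq
  have hsqd : ∀ y, HasFDerivAt (fun y => ‖Ω y‖ ^ 2) (2 • (innerSL ℝ (Ω y)).comp (fderiv ℝ Ω y)) y :=
    fun y => (hΩd y).hasFDerivAt.norm_sq
  have hgradθ : ∀ y, ⟪(fun z : EuclideanSpace ℝ (Fin 3) => z) y,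
      gradient (fun y => heatKernel 1 y * ‖Ω y‖ ^ 2) y⟫ =
      -(1 / 2 : ℝ) * (heatKernel 1 y * (‖y‖ ^ 2 * ‖Ω y‖ ^ 2)) +
        2 * (heatKernel 1 y * ⟪fderiv ℝ Ω y y, Ω y⟫) := by
    intro y
    rw [real_inner_comm, inner_gradient_left, fderiv_fun_mul (hKd y) (hsqd y).differentiableAt,
      _root_.add_apply, _root_.smul_apply, _root_.smul_apply,
      fderiv_norm_sq_apply_eq_two_mul_inner (hΩd y), fderiv_heatKernel_one_apply, smul_eq_mul,
      smul_eq_mul, real_inner_self_eq_norm_sq, real_inner_comm (Ω y)]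
    ring
  -- `div (y ↦ y) = 3`
  have hdivX : ∀ y : EuclideanSpace ℝ (Fin 3),
      VectorCalculus.divergence (fun z : EuclideanSpace ℝ (Fin 3) => z) y = 3 := by
    intro y; rw [divergence_fun_id_eq_finrank, finrank_euclideanSpace_fin]; norm_num
  -- continuity
  have cK : Continuous (heatKernel (E := EuclideanSpace ℝ (Fin 3)) 1) := continuous_heatKernel 1
  have cΩ : Continuous Ω := hΩ.continuous
  have cDΩ : Continuous (fderiv ℝ Ω) := hΩ.continuous_fderiv one_ne_zero
  -- integrability
  have i0 : Integrable fun y => (heatKernel 1 y * ‖Ω y‖ ^ 2) • (fun z : EuclideanSpace ℝ (Fin 3) => z) y := by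
    refine integrable_of_le_poly_heatKernel ((cK.mul (cΩ.norm.pow 2)).smul continuous_id)
      (C := C ^ 2) (N := 1) fun y => ?_
    rw [norm_smul, norm_mul, Real.norm_eq_abs, Real.norm_eq_abs, abs_of_pos (heatKernel_one_pos y),
      abs_of_nonneg (by positivity)]
    have h1 : ‖Ω y‖ ^ 2 ≤ C ^ 2 := pow_le_pow_left₀ (norm_nonneg _) (hΩb y) 2
    have hK0 := (heatKernel_one_pos y).le
    have hy : ‖y‖ ≤ (1 + ‖y‖) ^ 1 := by rw [pow_one]; linarith [norm_nonneg y]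
    calc heatKernel 1 y * ‖Ω y‖ ^ 2 * ‖y‖ ≤ heatKernel 1 y * C ^ 2 * (1 + ‖y‖) ^ 1 :=
          mul_le_mul (mul_le_mul_of_nonneg_left h1 hK0) hy (norm_nonneg _) (by positivity)
      _ = C ^ 2 * (1 + ‖y‖) ^ 1 * heatKernel 1 y := by ring
  have iE : Integrable fun y => heatKernel 1 y * ‖Ω y‖ ^ 2 :=
    integrable_of_le_poly_heatKernel (cK.mul (cΩ.norm.pow 2)) (C := C ^ 2) (N := 0) fun y => by
      rw [Real.norm_eq_abs, abs_mul, abs_of_pos (heatKernel_one_pos y), abs_of_nonneg (by positivity),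
        pow_zero, mul_one, mul_comm]
      exact mul_le_mul_of_nonneg_right (pow_le_pow_left₀ (norm_nonneg _) (hΩb y) 2)
        (heatKernel_one_pos y).le
  have i1 : Integrable fun y => (heatKernel 1 y * ‖Ω y‖ ^ 2) *
      VectorCalculus.divergence (fun z : EuclideanSpace ℝ (Fin 3) => z) y := by
    have e : (fun y => (heatKernel 1 y * ‖Ω y‖ ^ 2) *
        VectorCalculus.divergence (fun z : EuclideanSpace ℝ (Fin 3) => z) y) =
        fun y => 3 * (heatKernel 1 y * ‖Ω y‖ ^ 2) := by
      funext y; rw [hdivX y]; ring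
    rw [e]; exact iE.const_mul 3
  have iY : Integrable fun y => heatKernel 1 y * (‖y‖ ^ 2 * ‖Ω y‖ ^ 2) := by
    refine integrable_of_le_poly_heatKernel (cK.mul ((continuous_norm.pow 2).mul (cΩ.norm.pow 2)))
      (C := C ^ 2) (N := 2) fun y => ?_
    rw [Real.norm_eq_abs, abs_mul, abs_of_pos (heatKernel_one_pos y), abs_of_nonneg (by positivity)]
    have h1 : ‖Ω y‖ ^ 2 ≤ C ^ 2 := pow_le_pow_left₀ (norm_nonneg _) (hΩb y) 2
    have hy : ‖y‖ ^ 2 ≤ (1 + ‖y‖) ^ 2 :=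
      pow_le_pow_left₀ (norm_nonneg _) (by linarith [norm_nonneg y]) 2
    have hK0 := (heatKernel_one_pos y).le
    calc heatKernel 1 y * (‖y‖ ^ 2 * ‖Ω y‖ ^ 2) ≤ heatKernel 1 y * ((1 + ‖y‖) ^ 2 * C ^ 2) :=
          mul_le_mul_of_nonneg_left (mul_le_mul hy h1 (by positivity) (by positivity)) hK0
      _ = C ^ 2 * (1 + ‖y‖) ^ 2 * heatKernel 1 y := by ring
  have iD : Integrable fun y => heatKernel 1 y * ⟪fderiv ℝ Ω y y, Ω y⟫ := by
    refine integrable_of_le_poly_heatKernel (cK.mul ((cDΩ.clm_apply continuous_id).inner cΩ))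
      (C := C * C) (N := 1) fun y => ?_
    rw [Real.norm_eq_abs, abs_mul, abs_of_pos (heatKernel_one_pos y)]
    have h1 : |⟪fderiv ℝ Ω y y, Ω y⟫| ≤ C * (1 + ‖y‖) ^ 1 * C := by
      refine (abs_real_inner_le_norm _ _).trans (mul_le_mul ?_ (hΩb y) (norm_nonneg _) (by positivity))
      calc ‖fderiv ℝ Ω y y‖ ≤ ‖fderiv ℝ Ω y‖ * ‖y‖ := ContinuousLinearMap.le_opNorm _ _
        _ ≤ C * (1 + ‖y‖) ^ 1 :=
            mul_le_mul (hDΩb y) (by rw [pow_one]; linarith [norm_nonneg y]) (norm_nonneg _) hC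
    have hK0 := (heatKernel_one_pos y).le
    calc heatKernel 1 y * |⟪fderiv ℝ Ω y y, Ω y⟫| ≤ heatKernel 1 y * (C * (1 + ‖y‖) ^ 1 * C) :=
          mul_le_mul_of_nonneg_left h1 hK0
      _ = C * C * (1 + ‖y‖) ^ 1 * heatKernel 1 y := by ring
  have i2 : Integrable fun y => ⟪(fun z : EuclideanSpace ℝ (Fin 3) => z) y,
      gradient (fun y => heatKernel 1 y * ‖Ω y‖ ^ 2) y⟫ := by
    have e : (fun y => ⟪(fun z : EuclideanSpace ℝ (Fin 3) => z) y,
        gradient (fun y => heatKernel 1 y * ‖Ω y‖ ^ 2) y⟫) =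
        fun y => -(1 / 2 : ℝ) * (heatKernel 1 y * (‖y‖ ^ 2 * ‖Ω y‖ ^ 2)) +
          2 * (heatKernel 1 y * ⟪fderiv ℝ Ω y y, Ω y⟫) := funext hgradθ
    rw [e]
    exact (iY.const_mul _).add (iD.const_mul _)
  have key := integral_mul_divergence_add_eq_zero_of_integrable
    (θ := fun y => heatKernel 1 y * ‖Ω y‖ ^ 2) (u := fun z : EuclideanSpace ℝ (Fin 3) => z)
    hθ contDiff_id i0 i1 i2
  have h1 : ∫ y, (heatKernel 1 y * ‖Ω y‖ ^ 2) *
      VectorCalculus.divergence (fun z : EuclideanSpace ℝ (Fin 3) => z) y =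
      3 * ∫ y, heatKernel 1 y * ‖Ω y‖ ^ 2 := by
    rw [← integral_const_mul]
    refine integral_congr_ae (Eventually.of_forall fun y => ?_)
    simp only [hdivX y]; ring
  have h2 : ∫ y, ⟪(fun z : EuclideanSpace ℝ (Fin 3) => z) y,
      gradient (fun y => heatKernel 1 y * ‖Ω y‖ ^ 2) y⟫ =
      -(1 / 2 : ℝ) * (∫ y, heatKernel 1 y * (‖y‖ ^ 2 * ‖Ω y‖ ^ 2)) +
        2 * ∫ y, heatKernel 1 y * ⟪fderiv ℝ Ω y y, Ω y⟫ := by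
    rw [integral_congr_ae (Eventually.of_forall hgradθ), integral_add (iY.const_mul _) (iD.const_mul _),
      integral_const_mul, integral_const_mul]
  rw [h1, h2] at key
  linarith

/-- If `X ≤ εA + B/(4ε)` for every `ε > 0` (`A, B ≥ 0`), then `X ≤ √A · √B`. [folklore] -/
theorem le_sqrt_mul_sqrt_of_forall_le {X A B : ℝ} (hA : 0 ≤ A) (hB : 0 ≤ B)
    (h : ∀ ε : ℝ, 0 < ε → X ≤ ε * A + B / (4 * ε)) : X ≤ Real.sqrt A * Real.sqrt B := by
  rcases hA.eq_or_lt with hA0 | hApos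
  · -- `A = 0`: `X ≤ B/(4ε)` for every `ε`, hence `X ≤ 0`
    rw [← hA0, Real.sqrt_zero, zero_mul]
    by_contra hX
    rw [not_le] at hX
    have hX0 : X ≠ 0 := hX.ne'
    have hB1 : B + 1 ≠ 0 := by linarith
    have hε : 0 < (B + 1) / (4 * X) := by positivity
    have key := h _ hε
    rw [← hA0, mul_zero, zero_add] at key
    have e : B / (4 * ((B + 1) / (4 * X))) = X * (B / (B + 1)) := by
      field_simp
    rw [e] at key
    have hlt : B / (B + 1) < 1 := by rw [div_lt_one (by linarith)]; linarith
    nlinarith [mul_pos hX (sub_pos.2 hlt)]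
  rcases hB.eq_or_lt with hB0 | hBpos
  · -- `B = 0`: `X ≤ εA` for every `ε`, hence `X ≤ 0`
    rw [← hB0, Real.sqrt_zero, mul_zero]
    by_contra hX
    rw [not_le] at hX
    have hA0 : A ≠ 0 := hApos.ne'
    have hε : 0 < X / (2 * A) := by positivity
    have key := h _ hε
    rw [← hB0, zero_div, add_zero] at key
    have e : X / (2 * A) * A = X / 2 := by field_simp
    rw [e] at key
    linarith
  · -- `A, B > 0`: take `ε = ½ √(B/A)`
    have hsA := Real.sqrt_pos.2 hApos
    have hsB := Real.sqrt_pos.2 hBpos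
    have eA : Real.sqrt A * Real.sqrt A = A := Real.mul_self_sqrt hA
    have eB : Real.sqrt B * Real.sqrt B = B := Real.mul_self_sqrt hB
    set a := Real.sqrt A with ha_def
    set b := Real.sqrt B with hb_def
    have ha0 : a ≠ 0 := hsA.ne'
    have hb0 : b ≠ 0 := hsB.ne'
    have hε : 0 < b / (2 * a) := by positivity
    have key := h _ hε
    have e : b / (2 * a) * A + B / (4 * (b / (2 * a))) = a * b := by
      rw [← eA, ← eB]
      field_simp
      ring
    linarith

/-- **Weighted Cauchy–Schwarz against the heat kernel.** For continuous `a, b : ℝ³ → ℝ` of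
polynomial growth, `∫ K a b ≤ √(∫ K a²) · √(∫ K b²)` (`K = heatKernel 1`; pointwise Young
`ab ≤ εa² + b²/(4ε)` for every `ε > 0`, then `le_sqrt_mul_sqrt_of_forall_le`). [folklore] -/
theorem integral_heatKernel_mul_le_sqrt_mul_sqrt {a b : EuclideanSpace ℝ (Fin 3) → ℝ}
    (ha : Continuous a) (hb : Continuous b) {Ca Cb : ℝ} {Na Nb : ℕ}
    (haB : ∀ y, |a y| ≤ Ca * (1 + ‖y‖) ^ Na) (hbB : ∀ y, |b y| ≤ Cb * (1 + ‖y‖) ^ Nb) :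
    ∫ y, heatKernel 1 y * (a y * b y) ≤
      Real.sqrt (∫ y, heatKernel 1 y * a y ^ 2) * Real.sqrt (∫ y, heatKernel 1 y * b y ^ 2) := by
  have cK : Continuous (heatKernel (E := EuclideanSpace ℝ (Fin 3)) 1) := continuous_heatKernel 1
  have hCa : 0 ≤ Ca := by
    have := (abs_nonneg _).trans (haB 0); simpa using this
  have hCb : 0 ≤ Cb := by
    have := (abs_nonneg _).trans (hbB 0); simpa using this
  have iA : Integrable fun y => heatKernel 1 y * a y ^ 2 := by
    refine integrable_of_le_poly_heatKernel (cK.mul (ha.pow 2)) (C := Ca ^ 2) (N := 2 * Na) fun y => ?_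
    rw [Real.norm_eq_abs, abs_mul, abs_of_pos (heatKernel_one_pos y), abs_of_nonneg (sq_nonneg _)]
    have h1 : a y ^ 2 ≤ (Ca * (1 + ‖y‖) ^ Na) ^ 2 := by
      rw [← sq_abs]; exact pow_le_pow_left₀ (abs_nonneg _) (haB y) 2
    calc heatKernel 1 y * a y ^ 2 ≤ heatKernel 1 y * (Ca * (1 + ‖y‖) ^ Na) ^ 2 :=
          mul_le_mul_of_nonneg_left h1 (heatKernel_one_pos y).le
      _ = Ca ^ 2 * (1 + ‖y‖) ^ (2 * Na) * heatKernel 1 y := by ring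
  have iB : Integrable fun y => heatKernel 1 y * b y ^ 2 := by
    refine integrable_of_le_poly_heatKernel (cK.mul (hb.pow 2)) (C := Cb ^ 2) (N := 2 * Nb) fun y => ?_
    rw [Real.norm_eq_abs, abs_mul, abs_of_pos (heatKernel_one_pos y), abs_of_nonneg (sq_nonneg _)]
    have h1 : b y ^ 2 ≤ (Cb * (1 + ‖y‖) ^ Nb) ^ 2 := by
      rw [← sq_abs]; exact pow_le_pow_left₀ (abs_nonneg _) (hbB y) 2
    calc heatKernel 1 y * b y ^ 2 ≤ heatKernel 1 y * (Cb * (1 + ‖y‖) ^ Nb) ^ 2 :=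
          mul_le_mul_of_nonneg_left h1 (heatKernel_one_pos y).le
      _ = Cb ^ 2 * (1 + ‖y‖) ^ (2 * Nb) * heatKernel 1 y := by ring
  have iAB : Integrable fun y => heatKernel 1 y * (a y * b y) := by
    refine integrable_of_le_poly_heatKernel (cK.mul (ha.mul hb)) (C := Ca * Cb) (N := Na + Nb)
      fun y => ?_
    rw [Real.norm_eq_abs, abs_mul, abs_of_pos (heatKernel_one_pos y), abs_mul]
    calc heatKernel 1 y * (|a y| * |b y|)
        ≤ heatKernel 1 y * ((Ca * (1 + ‖y‖) ^ Na) * (Cb * (1 + ‖y‖) ^ Nb)) :=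
          mul_le_mul_of_nonneg_left (mul_le_mul (haB y) (hbB y) (abs_nonneg _) (by positivity))
            (heatKernel_one_pos y).le
      _ = Ca * Cb * (1 + ‖y‖) ^ (Na + Nb) * heatKernel 1 y := by ring
  refine le_sqrt_mul_sqrt_of_forall_le (integral_nonneg fun y => mul_nonneg (heatKernel_one_pos y).le
    (sq_nonneg _)) (integral_nonneg fun y => mul_nonneg (heatKernel_one_pos y).le (sq_nonneg _))
    fun ε hε => ?_
  have e : ε * (∫ y, heatKernel 1 y * a y ^ 2) + (∫ y, heatKernel 1 y * b y ^ 2) / (4 * ε) =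
      ∫ y, (ε * (heatKernel 1 y * a y ^ 2) + (heatKernel 1 y * b y ^ 2) / (4 * ε)) := by
    rw [integral_add (iA.const_mul ε) (iB.div_const (4 * ε)), integral_const_mul, integral_div]
  rw [e]
  refine integral_mono iAB ((iA.const_mul ε).add (iB.div_const (4 * ε))) fun y => ?_
  have hK0 := (heatKernel_one_pos y).le
  -- pointwise Young: `ab ≤ εa² + b²/(4ε)`
  have hy : a y * b y ≤ ε * a y ^ 2 + b y ^ 2 / (4 * ε) := by
    have h4 : 0 < 4 * ε := by positivity
    have : 0 ≤ (2 * ε * a y - b y) ^ 2 := sq_nonneg _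
    rw [show ε * a y ^ 2 + b y ^ 2 / (4 * ε) = ((2 * ε * a y) ^ 2 + b y ^ 2) / (4 * ε) by
      field_simp; ring]
    rw [le_div_iff₀ h4]
    nlinarith
  calc heatKernel 1 y * (a y * b y) ≤ heatKernel 1 y * (ε * a y ^ 2 + b y ^ 2 / (4 * ε)) :=
        mul_le_mul_of_nonneg_left hy hK0
    _ = ε * (heatKernel 1 y * a y ^ 2) + heatKernel 1 y * b y ^ 2 / (4 * ε) := by ring

end Summit.NavierStokesRegularity.NavierStokesRegularity.Theorems.GaussianGap
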